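/-
Copyright (c) 2026 the pub-hodgecm-mathlib formalisation cell (harness21).  Prover seat hodgecm-mathlib-K2E1-p09 (g4), Track B ∕ K2-LIT,
h413 = `stmt-HodgeConjecture-24833`, line `K2_E1_TraceFormulaBeta`, campaign RES-RANK-ONE, page «EIS-RANK-ONE», SPEC «EIS-R6» (Maass–Selberg by explicit truncation) rung R6c,
dealt by K2E1-plan (g3) 2026-09-04T04:44:42Z («EIS-R6abc» → p09).
-/
import Summits.HodgeConjecture.HodgeConjecture.Theorems.K2E1TruncatedEisensteinExplicit   -- ★ p857445 (this seat): R6b `Λ^T E(f) = E(f) − f − M f` on `{H > T}`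
import HarnessLib

/-!
# h413 ∕ Track B «K2-LIT», page EIS-RANK-ONE, rung R6c — `K2E1TruncatedEisensteinConstantTerm`: `(Λ^T E(f))_B ≡ 0` on the Siegel region `{H > T}`, `T ≥ 1`

Cell `pub/hodgecm-mathlib`, crux H413 = `stmt-HodgeConjecture-24833`, route `HCCMUnconditional`; dealer K2E1-plan (g3), SPEC `K2/K2E1-plan/g3/SPEC-EIS-R6-MaassSelberg.K2E1-plan-g3.md` §2 R6c.
THEOREMS ONLY (no `def`, no `instance`, no `notation`, no named-fact hypothesis, no `sorry`); lane `--kind proof --supports stmt-HodgeConjecture-24833 --as helper` (count-neutral).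

THE SHORT ROAD (no `T > 1`, no linearity of `Ψ`, no constant term of the two pieces of R6b's formula): the cut-off set `{H > T}` is `N(𝔸_F)`-stable (★ `borelHeight_unipotent_mul`), so for
`H(g) > T ≥ 1` R6b ★ `truncation_eisensteinSeriesU_apply_of_lt` reads, at EVERY `u g`, `u ∈ N(𝔸_F)`: `Λ^T E(f)(u g) = E(f)(u g) − f(g) − M f(g)` (`f`, `M f` left-`N(𝔸_F)`-invariant);
averaging over a fundamental domain `𝓕` of `N(F)` (`0 < ν(𝓕) < ∞`, `u ↦ E(f)(u g)` integrable on `𝓕`) gives `(Λ^T E f)_B(g) = E(f)_B(g) − f(g) − M f(g) = 0` by the constant-term identity `hCT`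
(hypothesis-first; discharged by ★ p857392 `borelConstantTerm_eisensteinSeriesU_two ∕ _three`).  This is the input «the correction `⟨Λ^T E f_z, Ψ(c_B^T E')⟩` vanishes» of R6f(ii).

* §1 `borelConstantTerm_truncation_eisensteinSeriesU_eq_sub_of_lt` (`= E(f)_B(g) − f(g) − M f(g)`) and **`borelConstantTerm_truncation_eisensteinSeriesU_eq_zero_of_lt`** (`= 0`), `N`-generic
  under `hSiegel`; §2 the `U(J₃)` ∕ `U(J₂)` instances.

HONEST LABEL.  Count-neutral helper; proves no printed statement; HC_CM is proved only modulo the 7 printed citations (2 remaining named inputs: hLiu418 =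
`stmt-HodgeConjecture-24832`, h413 = `stmt-HodgeConjecture-24833`) until rung 0 closes.

## References
* [Arthur1980TraceFormulaII] J. Arthur, *A trace formula for reductive groups II: applications of a truncation operator*, Compositio Math. 40 (1980), §1.
* [Garrett2018] P. Garrett, *Modern Analysis of Automorphic Forms by Example* 1 (2018), §1.11 and §2.11 (`(∧^T E_s)_P` vanishes above the cut-off).
* [MoeglinWaldspurger1995] C. Mœglin, J.-L. Waldspurger, *Spectral decomposition and Eisenstein series* (1995), I.2.13, IV.2.
-/

set_option autoImplicit false
set_option linter.dupNamespace false  -- the mandated namespace repeats the summit's segment (`HodgeConjecture.HodgeConjecture`)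

noncomputable section
open MeasureTheory NumberField IsDedekindDomain Matrix MulAction
open Literature.NumberTheory.Automorphic Literature.NumberTheory.Automorphic.UnitaryGroup AdelicGroupData
open Summit.HodgeConjecture.HodgeConjecture.Cruxes.H413.K2E1BorelEisensteinU
open Summit.HodgeConjecture.HodgeConjecture.Cruxes.H413.K2E1TruncatedEisensteinExplicit
open scoped MatrixGroups NNReal ENNReal

namespace Summit.HodgeConjecture.HodgeConjecture.Cruxes.H413.K2E1TruncatedEisensteinConstantTerm

variable {F E : Type} [Field F] [NumberField F] [Field E] [NumberField E] [Algebra F E] {c : E ≃ₐ[F] E} {N : ℕ} [NeZero N]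

/-! ## §1 `(Λ^T E(f))_B(g) = E(f)_B(g) − f(g) − M f(g) = 0` for `H(g) > T ≥ 1` -/

section General

variable [MeasurableSpace (adelicUnipotent F E c N)]

/-- Pointwise on the `N(𝔸_F)`-orbit of a high point: `Λ^T E(f)(u g) = E(f)(u g) − (f(g) + M f(g))` for every `u ∈ N(𝔸_F)` when `H(g) > T ≥ 1` (R6b at `u g`, `H(u g) = H(g)`,
`N(𝔸_F)`-invariance of `f` and `M f`). [cite: Garrett2018, §1.11 and §2.11] -/
theorem truncation_eisensteinSeriesU_unipotent_mul_of_lt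
    (hSiegel : ∀ γ : (quasiSplit F E c N).arithmeticSubgroup, γ ∉ arithmeticBorel F E c N →
      ∀ g : (quasiSplit F E c N).Adelic, borelHeight ((γ : (quasiSplit F E c N).Adelic) * g) * borelHeight g ≤ 1)
    {ν : Measure (adelicUnipotent F E c N)} {𝓕 : Set (adelicUnipotent F E c N)} {T : ℝ≥0} (hT : 1 ≤ T)
    {f Mf : (quasiSplit F E c N).Adelic → ℂ}
    (hf : ∀ b ∈ arithmeticBorel F E c N, ∀ x : (quasiSplit F E c N).Adelic, f ((b : (quasiSplit F E c N).Adelic) * x) = f x)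
    (hMf : ∀ b ∈ arithmeticBorel F E c N, ∀ x : (quasiSplit F E c N).Adelic, Mf ((b : (quasiSplit F E c N).Adelic) * x) = Mf x)
    (hfN : ∀ u ∈ adelicUnipotent F E c N, ∀ x : (quasiSplit F E c N).Adelic, f (u * x) = f x)
    (hMfN : ∀ u ∈ adelicUnipotent F E c N, ∀ x : (quasiSplit F E c N).Adelic, Mf (u * x) = Mf x)
    (hCT : ∀ x : (quasiSplit F E c N).Adelic, T < borelHeight x → borelConstantTerm ν 𝓕 (eisensteinSeriesU f) x = f x + Mf x)
    {g : (quasiSplit F E c N).Adelic} (hg : T < borelHeight g) (u : adelicUnipotent F E c N) :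
    truncation ν 𝓕 T (eisensteinSeriesU f) ((u : (quasiSplit F E c N).Adelic) * g) =
      eisensteinSeriesU f ((u : (quasiSplit F E c N).Adelic) * g) - (f g + Mf g) := by
  have hug : T < borelHeight ((u : (quasiSplit F E c N).Adelic) * g) := by rw [borelHeight_unipotent_mul u.2]; exact hg
  rw [truncation_eisensteinSeriesU_apply_of_lt hSiegel hT hf hMf hCT hug, hfN _ u.2 g, hMfN _ u.2 g]
  ring

/-- **`(Λ^T E(f))_B(g) = E(f)_B(g) − f(g) − M f(g)`** for `H(g) > T ≥ 1`, given `0 < ν(𝓕) < ∞` and `u ↦ E(f)(u g)` integrable on the fundamental domain `𝓕`.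
[cite: Garrett2018, §1.11 and §2.11] [cite: MoeglinWaldspurger1995, I.2.13] -/
theorem borelConstantTerm_truncation_eisensteinSeriesU_eq_sub_of_lt
    (hSiegel : ∀ γ : (quasiSplit F E c N).arithmeticSubgroup, γ ∉ arithmeticBorel F E c N →
      ∀ g : (quasiSplit F E c N).Adelic, borelHeight ((γ : (quasiSplit F E c N).Adelic) * g) * borelHeight g ≤ 1)
    {ν : Measure (adelicUnipotent F E c N)} {𝓕 : Set (adelicUnipotent F E c N)} {T : ℝ≥0} (hT : 1 ≤ T)
    {f Mf : (quasiSplit F E c N).Adelic → ℂ}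
    (hf : ∀ b ∈ arithmeticBorel F E c N, ∀ x : (quasiSplit F E c N).Adelic, f ((b : (quasiSplit F E c N).Adelic) * x) = f x)
    (hMf : ∀ b ∈ arithmeticBorel F E c N, ∀ x : (quasiSplit F E c N).Adelic, Mf ((b : (quasiSplit F E c N).Adelic) * x) = Mf x)
    (hfN : ∀ u ∈ adelicUnipotent F E c N, ∀ x : (quasiSplit F E c N).Adelic, f (u * x) = f x)
    (hMfN : ∀ u ∈ adelicUnipotent F E c N, ∀ x : (quasiSplit F E c N).Adelic, Mf (u * x) = Mf x)
    (hCT : ∀ x : (quasiSplit F E c N).Adelic, T < borelHeight x → borelConstantTerm ν 𝓕 (eisensteinSeriesU f) x = f x + Mf x)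
    (h𝓕₀ : ν 𝓕 ≠ 0) (h𝓕top : ν 𝓕 ≠ ∞) {g : (quasiSplit F E c N).Adelic}
    (hint : IntegrableOn (fun u : adelicUnipotent F E c N => eisensteinSeriesU f ((u : (quasiSplit F E c N).Adelic) * g)) 𝓕 ν)
    (hg : T < borelHeight g) :
    borelConstantTerm ν 𝓕 (truncation ν 𝓕 T (eisensteinSeriesU f)) g = borelConstantTerm ν 𝓕 (eisensteinSeriesU f) g - f g - Mf g := by
  have hr : (ν 𝓕).toReal ≠ 0 := ENNReal.toReal_ne_zero.2 ⟨h𝓕₀, h𝓕top⟩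
  rw [borelConstantTerm_def, borelConstantTerm_def]
  simp_rw [truncation_eisensteinSeriesU_unipotent_mul_of_lt hSiegel hT hf hMf hfN hMfN hCT hg]
  rw [integral_sub hint (integrableOn_const h𝓕top), setIntegral_const, measureReal_def, smul_sub, smul_smul, inv_mul_cancel₀ hr, one_smul]
  ring

/-- **`(Λ^T E(f))_B ≡ 0` ON THE SIEGEL REGION `{H > T}`**, `T ≥ 1` (`F`-rank one): with §1's formula and `hCT` at `g` — Arthur's «`Λ^T φ` is rapidly decreasing because its constant
terms vanish above the cut-off», for `φ = E(f)` and `P = B`. [cite: Arthur1980TraceFormulaII, §1] [cite: Garrett2018, §1.11 and §2.11] [cite: MoeglinWaldspurger1995, IV.2] -/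
theorem borelConstantTerm_truncation_eisensteinSeriesU_eq_zero_of_lt
    (hSiegel : ∀ γ : (quasiSplit F E c N).arithmeticSubgroup, γ ∉ arithmeticBorel F E c N →
      ∀ g : (quasiSplit F E c N).Adelic, borelHeight ((γ : (quasiSplit F E c N).Adelic) * g) * borelHeight g ≤ 1)
    {ν : Measure (adelicUnipotent F E c N)} {𝓕 : Set (adelicUnipotent F E c N)} {T : ℝ≥0} (hT : 1 ≤ T)
    {f Mf : (quasiSplit F E c N).Adelic → ℂ}
    (hf : ∀ b ∈ arithmeticBorel F E c N, ∀ x : (quasiSplit F E c N).Adelic, f ((b : (quasiSplit F E c N).Adelic) * x) = f x)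
    (hMf : ∀ b ∈ arithmeticBorel F E c N, ∀ x : (quasiSplit F E c N).Adelic, Mf ((b : (quasiSplit F E c N).Adelic) * x) = Mf x)
    (hfN : ∀ u ∈ adelicUnipotent F E c N, ∀ x : (quasiSplit F E c N).Adelic, f (u * x) = f x)
    (hMfN : ∀ u ∈ adelicUnipotent F E c N, ∀ x : (quasiSplit F E c N).Adelic, Mf (u * x) = Mf x)
    (hCT : ∀ x : (quasiSplit F E c N).Adelic, T < borelHeight x → borelConstantTerm ν 𝓕 (eisensteinSeriesU f) x = f x + Mf x)
    (h𝓕₀ : ν 𝓕 ≠ 0) (h𝓕top : ν 𝓕 ≠ ∞) {g : (quasiSplit F E c N).Adelic}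
    (hint : IntegrableOn (fun u : adelicUnipotent F E c N => eisensteinSeriesU f ((u : (quasiSplit F E c N).Adelic) * g)) 𝓕 ν)
    (hg : T < borelHeight g) :
    borelConstantTerm ν 𝓕 (truncation ν 𝓕 T (eisensteinSeriesU f)) g = 0 := by
  rw [borelConstantTerm_truncation_eisensteinSeriesU_eq_sub_of_lt hSiegel hT hf hMf hfN hMfN hCT h𝓕₀ h𝓕top hint hg, hCT g hg]
  ring

/-- Hence the TAIL of the constant term of `Λ^T E(f)` vanishes identically: `c_B^T (Λ^T E f) = 0` as a function (`T ≥ 1`; the hypotheses of §1 at every high `g`) — so `Λ^T (Λ^T E f) = Λ^T E f`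
and `⟨Λ^T E f, Ψ(c_B^T ψ)⟩`-type corrections unfold against `0`. [cite: Garrett2018, §2.11] -/
theorem constantTermTail_truncation_eisensteinSeriesU_eq_zero
    (hSiegel : ∀ γ : (quasiSplit F E c N).arithmeticSubgroup, γ ∉ arithmeticBorel F E c N →
      ∀ g : (quasiSplit F E c N).Adelic, borelHeight ((γ : (quasiSplit F E c N).Adelic) * g) * borelHeight g ≤ 1)
    {ν : Measure (adelicUnipotent F E c N)} {𝓕 : Set (adelicUnipotent F E c N)} {T : ℝ≥0} (hT : 1 ≤ T)
    {f Mf : (quasiSplit F E c N).Adelic → ℂ}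
    (hf : ∀ b ∈ arithmeticBorel F E c N, ∀ x : (quasiSplit F E c N).Adelic, f ((b : (quasiSplit F E c N).Adelic) * x) = f x)
    (hMf : ∀ b ∈ arithmeticBorel F E c N, ∀ x : (quasiSplit F E c N).Adelic, Mf ((b : (quasiSplit F E c N).Adelic) * x) = Mf x)
    (hfN : ∀ u ∈ adelicUnipotent F E c N, ∀ x : (quasiSplit F E c N).Adelic, f (u * x) = f x)
    (hMfN : ∀ u ∈ adelicUnipotent F E c N, ∀ x : (quasiSplit F E c N).Adelic, Mf (u * x) = Mf x)
    (hCT : ∀ x : (quasiSplit F E c N).Adelic, T < borelHeight x → borelConstantTerm ν 𝓕 (eisensteinSeriesU f) x = f x + Mf x)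
    (h𝓕₀ : ν 𝓕 ≠ 0) (h𝓕top : ν 𝓕 ≠ ∞)
    (hint : ∀ g : (quasiSplit F E c N).Adelic, T < borelHeight g →
      IntegrableOn (fun u : adelicUnipotent F E c N => eisensteinSeriesU f ((u : (quasiSplit F E c N).Adelic) * g)) 𝓕 ν) :
    constantTermTail ν 𝓕 T (truncation ν 𝓕 T (eisensteinSeriesU f)) = 0 := by
  funext g
  by_cases hg : T < borelHeight g
  · rw [constantTermTail_of_lt _ hg, Pi.zero_apply]
    exact borelConstantTerm_truncation_eisensteinSeriesU_eq_zero_of_lt hSiegel hT hf hMf hfN hMfN hCT h𝓕₀ h𝓕top (hint g hg) hg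
  · rw [constantTermTail_of_not_lt _ hg, Pi.zero_apply]

/-- **`Λ^T` IS IDEMPOTENT ON `E(f)`** (`T ≥ 1`, rank one): `Λ^T (Λ^T E f) = Λ^T E f`, since `c_B^T(Λ^T E f) = 0`. [cite: Garrett2018, §2.11] -/
theorem truncation_truncation_eisensteinSeriesU
    (hSiegel : ∀ γ : (quasiSplit F E c N).arithmeticSubgroup, γ ∉ arithmeticBorel F E c N →
      ∀ g : (quasiSplit F E c N).Adelic, borelHeight ((γ : (quasiSplit F E c N).Adelic) * g) * borelHeight g ≤ 1)
    {ν : Measure (adelicUnipotent F E c N)} {𝓕 : Set (adelicUnipotent F E c N)} {T : ℝ≥0} (hT : 1 ≤ T)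
    {f Mf : (quasiSplit F E c N).Adelic → ℂ}
    (hf : ∀ b ∈ arithmeticBorel F E c N, ∀ x : (quasiSplit F E c N).Adelic, f ((b : (quasiSplit F E c N).Adelic) * x) = f x)
    (hMf : ∀ b ∈ arithmeticBorel F E c N, ∀ x : (quasiSplit F E c N).Adelic, Mf ((b : (quasiSplit F E c N).Adelic) * x) = Mf x)
    (hfN : ∀ u ∈ adelicUnipotent F E c N, ∀ x : (quasiSplit F E c N).Adelic, f (u * x) = f x)
    (hMfN : ∀ u ∈ adelicUnipotent F E c N, ∀ x : (quasiSplit F E c N).Adelic, Mf (u * x) = Mf x)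
    (hCT : ∀ x : (quasiSplit F E c N).Adelic, T < borelHeight x → borelConstantTerm ν 𝓕 (eisensteinSeriesU f) x = f x + Mf x)
    (h𝓕₀ : ν 𝓕 ≠ 0) (h𝓕top : ν 𝓕 ≠ ∞)
    (hint : ∀ g : (quasiSplit F E c N).Adelic, T < borelHeight g →
      IntegrableOn (fun u : adelicUnipotent F E c N => eisensteinSeriesU f ((u : (quasiSplit F E c N).Adelic) * g)) 𝓕 ν)
    (g : (quasiSplit F E c N).Adelic) :
    truncation ν 𝓕 T (truncation ν 𝓕 T (eisensteinSeriesU f)) g = truncation ν 𝓕 T (eisensteinSeriesU f) g := by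
  rw [truncation_def, constantTermTail_truncation_eisensteinSeriesU_eq_zero hSiegel hT hf hMf hfN hMfN hCT h𝓕₀ h𝓕top hint, pseudoEisenstein_zero, sub_zero]

end General

/-! ## §2 The rank-one instances `U(J₃)`, `U(J₂)` -/

section Instances

/-- **`(Λ^T E(f))_B(g) = 0` on `U(J₃)`** for `H(g) > T ≥ 1`. [cite: Garrett2018, §1.11 and §2.11] -/
theorem borelConstantTerm_truncation_eisensteinSeriesU_eq_zero_of_lt_three {F E : Type} [Field F] [NumberField F] [Field E] [NumberField E] [Algebra F E]
    {c : E ≃ₐ[F] E} [MeasurableSpace (adelicUnipotent F E c 3)] {ν : Measure (adelicUnipotent F E c 3)} {𝓕 : Set (adelicUnipotent F E c 3)} {T : ℝ≥0} (hT : 1 ≤ T)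
    {f Mf : (quasiSplit F E c 3).Adelic → ℂ}
    (hf : ∀ b ∈ arithmeticBorel F E c 3, ∀ x : (quasiSplit F E c 3).Adelic, f ((b : (quasiSplit F E c 3).Adelic) * x) = f x)
    (hMf : ∀ b ∈ arithmeticBorel F E c 3, ∀ x : (quasiSplit F E c 3).Adelic, Mf ((b : (quasiSplit F E c 3).Adelic) * x) = Mf x)
    (hfN : ∀ u ∈ adelicUnipotent F E c 3, ∀ x : (quasiSplit F E c 3).Adelic, f (u * x) = f x)
    (hMfN : ∀ u ∈ adelicUnipotent F E c 3, ∀ x : (quasiSplit F E c 3).Adelic, Mf (u * x) = Mf x)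
    (hCT : ∀ x : (quasiSplit F E c 3).Adelic, T < borelHeight x → borelConstantTerm ν 𝓕 (eisensteinSeriesU f) x = f x + Mf x)
    (h𝓕₀ : ν 𝓕 ≠ 0) (h𝓕top : ν 𝓕 ≠ ∞) {g : (quasiSplit F E c 3).Adelic}
    (hint : IntegrableOn (fun u : adelicUnipotent F E c 3 => eisensteinSeriesU f ((u : (quasiSplit F E c 3).Adelic) * g)) 𝓕 ν)
    (hg : T < borelHeight g) :
    borelConstantTerm ν 𝓕 (truncation ν 𝓕 T (eisensteinSeriesU f)) g = 0 :=
  borelConstantTerm_truncation_eisensteinSeriesU_eq_zero_of_lt siegel_three hT hf hMf hfN hMfN hCT h𝓕₀ h𝓕top hint hg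

/-- **`(Λ^T E(f))_B(g) = 0` on `U(J₂)`** for `H(g) > T ≥ 1`. [cite: Garrett2018, §1.11 and §2.11] -/
theorem borelConstantTerm_truncation_eisensteinSeriesU_eq_zero_of_lt_two {F E : Type} [Field F] [NumberField F] [Field E] [NumberField E] [Algebra F E]
    {c : E ≃ₐ[F] E} [MeasurableSpace (adelicUnipotent F E c 2)] {ν : Measure (adelicUnipotent F E c 2)} {𝓕 : Set (adelicUnipotent F E c 2)} {T : ℝ≥0} (hT : 1 ≤ T)
    {f Mf : (quasiSplit F E c 2).Adelic → ℂ}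
    (hf : ∀ b ∈ arithmeticBorel F E c 2, ∀ x : (quasiSplit F E c 2).Adelic, f ((b : (quasiSplit F E c 2).Adelic) * x) = f x)
    (hMf : ∀ b ∈ arithmeticBorel F E c 2, ∀ x : (quasiSplit F E c 2).Adelic, Mf ((b : (quasiSplit F E c 2).Adelic) * x) = Mf x)
    (hfN : ∀ u ∈ adelicUnipotent F E c 2, ∀ x : (quasiSplit F E c 2).Adelic, f (u * x) = f x)
    (hMfN : ∀ u ∈ adelicUnipotent F E c 2, ∀ x : (quasiSplit F E c 2).Adelic, Mf (u * x) = Mf x)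
    (hCT : ∀ x : (quasiSplit F E c 2).Adelic, T < borelHeight x → borelConstantTerm ν 𝓕 (eisensteinSeriesU f) x = f x + Mf x)
    (h𝓕₀ : ν 𝓕 ≠ 0) (h𝓕top : ν 𝓕 ≠ ∞) {g : (quasiSplit F E c 2).Adelic}
    (hint : IntegrableOn (fun u : adelicUnipotent F E c 2 => eisensteinSeriesU f ((u : (quasiSplit F E c 2).Adelic) * g)) 𝓕 ν)
    (hg : T < borelHeight g) :
    borelConstantTerm ν 𝓕 (truncation ν 𝓕 T (eisensteinSeriesU f)) g = 0 :=
  borelConstantTerm_truncation_eisensteinSeriesU_eq_zero_of_lt siegel_two hT hf hMf hfN hMfN hCT h𝓕₀ h𝓕top hint hg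

/-- `c_B^T(Λ^T E f) = 0` on `U(J₃)`, `T ≥ 1`. [cite: Garrett2018, §2.11] -/
theorem constantTermTail_truncation_eisensteinSeriesU_eq_zero_three {F E : Type} [Field F] [NumberField F] [Field E] [NumberField E] [Algebra F E]
    {c : E ≃ₐ[F] E} [MeasurableSpace (adelicUnipotent F E c 3)] {ν : Measure (adelicUnipotent F E c 3)} {𝓕 : Set (adelicUnipotent F E c 3)} {T : ℝ≥0} (hT : 1 ≤ T)
    {f Mf : (quasiSplit F E c 3).Adelic → ℂ}
    (hf : ∀ b ∈ arithmeticBorel F E c 3, ∀ x : (quasiSplit F E c 3).Adelic, f ((b : (quasiSplit F E c 3).Adelic) * x) = f x)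
    (hMf : ∀ b ∈ arithmeticBorel F E c 3, ∀ x : (quasiSplit F E c 3).Adelic, Mf ((b : (quasiSplit F E c 3).Adelic) * x) = Mf x)
    (hfN : ∀ u ∈ adelicUnipotent F E c 3, ∀ x : (quasiSplit F E c 3).Adelic, f (u * x) = f x)
    (hMfN : ∀ u ∈ adelicUnipotent F E c 3, ∀ x : (quasiSplit F E c 3).Adelic, Mf (u * x) = Mf x)
    (hCT : ∀ x : (quasiSplit F E c 3).Adelic, T < borelHeight x → borelConstantTerm ν 𝓕 (eisensteinSeriesU f) x = f x + Mf x)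
    (h𝓕₀ : ν 𝓕 ≠ 0) (h𝓕top : ν 𝓕 ≠ ∞)
    (hint : ∀ g : (quasiSplit F E c 3).Adelic, T < borelHeight g →
      IntegrableOn (fun u : adelicUnipotent F E c 3 => eisensteinSeriesU f ((u : (quasiSplit F E c 3).Adelic) * g)) 𝓕 ν) :
    constantTermTail ν 𝓕 T (truncation ν 𝓕 T (eisensteinSeriesU f)) = 0 :=
  constantTermTail_truncation_eisensteinSeriesU_eq_zero siegel_three hT hf hMf hfN hMfN hCT h𝓕₀ h𝓕top hint

/-- `c_B^T(Λ^T E f) = 0` on `U(J₂)`, `T ≥ 1`. [cite: Garrett2018, §2.11] -/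
theorem constantTermTail_truncation_eisensteinSeriesU_eq_zero_two {F E : Type} [Field F] [NumberField F] [Field E] [NumberField E] [Algebra F E]
    {c : E ≃ₐ[F] E} [MeasurableSpace (adelicUnipotent F E c 2)] {ν : Measure (adelicUnipotent F E c 2)} {𝓕 : Set (adelicUnipotent F E c 2)} {T : ℝ≥0} (hT : 1 ≤ T)
    {f Mf : (quasiSplit F E c 2).Adelic → ℂ}
    (hf : ∀ b ∈ arithmeticBorel F E c 2, ∀ x : (quasiSplit F E c 2).Adelic, f ((b : (quasiSplit F E c 2).Adelic) * x) = f x)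
    (hMf : ∀ b ∈ arithmeticBorel F E c 2, ∀ x : (quasiSplit F E c 2).Adelic, Mf ((b : (quasiSplit F E c 2).Adelic) * x) = Mf x)
    (hfN : ∀ u ∈ adelicUnipotent F E c 2, ∀ x : (quasiSplit F E c 2).Adelic, f (u * x) = f x)
    (hMfN : ∀ u ∈ adelicUnipotent F E c 2, ∀ x : (quasiSplit F E c 2).Adelic, Mf (u * x) = Mf x)
    (hCT : ∀ x : (quasiSplit F E c 2).Adelic, T < borelHeight x → borelConstantTerm ν 𝓕 (eisensteinSeriesU f) x = f x + Mf x)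
    (h𝓕₀ : ν 𝓕 ≠ 0) (h𝓕top : ν 𝓕 ≠ ∞)
    (hint : ∀ g : (quasiSplit F E c 2).Adelic, T < borelHeight g →
      IntegrableOn (fun u : adelicUnipotent F E c 2 => eisensteinSeriesU f ((u : (quasiSplit F E c 2).Adelic) * g)) 𝓕 ν) :
    constantTermTail ν 𝓕 T (truncation ν 𝓕 T (eisensteinSeriesU f)) = 0 :=
  constantTermTail_truncation_eisensteinSeriesU_eq_zero siegel_two hT hf hMf hfN hMfN hCT h𝓕₀ h𝓕top hint

end Instances

end Summit.HodgeConjecture.HodgeConjecture.Cruxes.H413.K2E1TruncatedEisensteinConstantTerm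

end
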